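import Literature.Computability.Complexity.StockmeyerEstimator
import Literature.Computability.Complexity.ValiantVaziraniLemma
import Literature.Computability.Complexity.CoinChunks
import Literature.Computability.Complexity.UniformProbBlocks
import HarnessLib

/-!
# `CF = Ker ⟹ PH = ZPP^NP` (Fortnow–Grochow 2011, Cor. 3.4), part II: the randomized halving of the bad set

Second file of the proof of `Literature.Computability.Complexity.blassGurevich_CF_eq_Ker_PH` (see
`EquivalenceProblemsSelector.lean` for part I and the overall architecture). Pure combinatorics and
counting; no strings of the machine appear except the coin layout `Stockmeyer.coinHash` of
`StockmeyerEstimator.lean` (row `j` of the level-`k` affine hash `{0,1}^M → {0,1}^k` at coins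
`j(M+1) … j(M+1)+M`), through which the events are counted (`Stockmeyer.card_filter_coinHash`).

Where the printed proof (FG Cor. 3.4) invokes Köbler–Watanabe 1998 (`NP ⊆ (NP ∩ coNP)/poly ⟹
PH = ZPP^NP`, whose `ZPP^NP` algorithm *learns* correct advice by halving a version space with
random samples), the tree constructs the specific advice of Hemaspaandra–Naik–Ogihara–Selman (a list
of members beating every other member; part I) directly, by the following randomized halving with an
`NP` oracle — the deviation from print, using only tools already in the tree (affine hashing,
`AffineHashing.lean`; the good level of Valiant–Vazirani, `ValiantVaziraniLemma.lean`):

* **One round.** Given the current advice `K` with bad set `B` (members passing the certificate),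
  draw a random affine hash and, for every level `k`, let the oracle search return *some bad element
  hashed to zero at level `k`* whenever one exists; append everything found to `K`. The new bad set
  lies in the out-neighbourhood of each appended element in the (oriented) beating graph (part I,
  `CFKer.bad_append_iff`, `CFKer.not_beats_symm`).
* **Analysis** (`CFKer.round_sum_le`): at the good level `2^{k-2} ≤ |B| ≤ 2^{k-1}`
  (`AffineHash.exists_goodLevel`), `P[a is returned] ≤ P[h_k(a) = 0] = 2^{-k}` for every `a ∈ B`
  (`card_filter_hash_eq`), the out-degrees sum to `≤ |B|(|B|-1)/2` (`sum_outdeg_le`, antisymmetry),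
  and `P[no bad element at level k] ≤ 1 - |B| 2^{-k} + |B|(|B|-1) 2^{-2k}/2` (`card_exists_hash_ge`);
  together `E |B'| ≤ (29/32) |B|`.
* **Iteration** (`CFKer.iterate_sum_le`): for a process whose potential shrinks in expectation by
  the factor `c` in every round, from every state, the expected potential after `T` independent
  rounds is `≤ c^T` times the initial one (induction, peeling the first round); with `T = 8(M+1)`
  rounds and `|B₀| ≤ 2^M`, `P[B_T ≠ ∅] ≤ E|B_T| ≤ (29/32)^{8(M+1)} 2^M ≤ 1/2`
  (`CFKer.prob_nonempty_le_half`).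

## References

* L. Fortnow, J. A. Grochow, *Complexity classes of equivalence problems revisited*, Inform. and
  Comput. 209 (2011) 748–763 = arXiv:0907.4775, Cor. 3.4.
* L. A. Hemaspaandra, A. V. Naik, M. Ogihara, A. L. Selman, *Computing solutions uniquely collapses
  the polynomial hierarchy*, SIAM J. Comput. 25 (1996) 697–708, proof of Thm. 1.
* J. Köbler, O. Watanabe, *New collapse consequences of NP having small circuits*, SIAM J. Comput.
  28 (1998) 311–324, Thm. 13 (the `ZPP^NP` upper bound replaced here).
* S. Arora, B. Barak, *Computational Complexity: A Modern Approach*, CUP 2009, Def. 8.14 / Thm. 8.15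
  (pairwise independent hashing), Lemma 17.19 (good level).
-/

namespace Literature.Computability.Complexity

open Finset

open scoped Classical

namespace CFKer

/-! ### Oriented graphs: the out-degrees sum to at most `|B|(|B|-1)/2` -/

/-- In an oriented graph on `B` (no two elements beat each other) the out-degrees sum to at most
`|B| (|B| - 1) / 2`: the edge set and its reverse are disjoint subsets of the off-diagonal.
[folklore] -/
theorem two_mul_sum_outdeg_le {α : Type*} (B : Finset α) (beat : α → α → Prop)
    (hanti : ∀ a ∈ B, ∀ b ∈ B, beat a b → ¬ beat b a) :
    2 * ∑ a ∈ B, (B.filter (beat a)).card ≤ B.card * (B.card - 1) := by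
  set E : Finset (α × α) := (B ×ˢ B).filter fun p => beat p.1 p.2 with hE
  have hsum : ∑ a ∈ B, (B.filter (beat a)).card = E.card := by
    rw [hE, card_filter, sum_product]
    refine sum_congr rfl fun a _ => ?_
    rw [card_filter]
  set E' : Finset (α × α) := E.map ⟨Prod.swap, Prod.swap_injective⟩ with hE'
  have hEoff : E ⊆ B.offDiag := by
    intro p hp
    rw [hE, mem_filter, mem_product] at hp
    rw [mem_offDiag]
    refine ⟨hp.1.1, hp.1.2, fun h => ?_⟩
    exact hanti _ hp.1.1 _ hp.1.2 hp.2 (h ▸ hp.2)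
  have hE'off : E' ⊆ B.offDiag := by
    intro p hp
    rw [hE', mem_map] at hp
    obtain ⟨q, hq, rfl⟩ := hp
    have := hEoff hq
    rw [mem_offDiag] at this ⊢
    exact ⟨this.2.1, this.1, fun h => this.2.2 h.symm⟩
  have hdisj : Disjoint E E' := by
    rw [disjoint_left]
    intro p hp hp'
    rw [hE', mem_map] at hp'
    obtain ⟨q, hq, rfl⟩ := hp'
    rw [hE, mem_filter, mem_product] at hp hq
    exact hanti _ hq.1.1 _ hq.1.2 hq.2 hp.2
  have hcard : (E ∪ E').card ≤ B.offDiag.card := card_le_card (union_subset hEoff hE'off)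
  rw [card_union_of_disjoint hdisj, card_map, offDiag_card] at hcard
  rw [hsum, Nat.mul_sub_one, two_mul]
  exact hcard

/-- Real form: `Σ_a outdeg a ≤ |B| (|B| - 1) / 2`. [folklore] -/
theorem sum_outdeg_le {α : Type*} (B : Finset α) (beat : α → α → Prop)
    (hanti : ∀ a ∈ B, ∀ b ∈ B, beat a b → ¬ beat b a) :
    (∑ a ∈ B, ((B.filter (beat a)).card : ℝ)) ≤ B.card * (B.card - 1) / 2 := by
  have h := two_mul_sum_outdeg_le B beat hanti
  rcases Nat.eq_zero_or_pos B.card with h0 | hpos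
  · rw [Finset.card_eq_zero.1 h0]; simp
  · have hcast : ((B.card * (B.card - 1) : ℕ) : ℝ) = B.card * (B.card - 1) := by
      rw [Nat.cast_mul, Nat.cast_sub hpos, Nat.cast_one]
    have h' : (2 : ℝ) * ∑ a ∈ B, ((B.filter (beat a)).card : ℝ) ≤ B.card * (B.card - 1) := by
      rw [← hcast]; exact_mod_cast h
    linarith

/-! ### One round at a fixed level -/

section Round

open AffineHash Stockmeyer

variable {α : Type*} {M k ℓ : ℕ}

/-- The number of coin strings of length `ℓ`. [folklore] -/
theorem card_coins (ℓ : ℕ) : Fintype.card (List.Vector Bool ℓ) = 2 ^ ℓ := by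
  rw [card_vector, Fintype.card_bool]

/-- One-point uniformity through the coin layout: exactly a `2^{-k}` fraction of the coin strings
hash a given point to zero at level `k`. [Arora–Barak 2009, Def. 8.14] [folklore] -/
theorem card_coins_hash_eq_zero (hℓ : k * (M + 1) ≤ ℓ) (x : Fin M → ZMod 2) :
    (univ.filter fun u : List.Vector Bool ℓ => hash (coinHash u.toList M k) x = 0).card * 2 ^ k = 2 ^ ℓ := by
  -- `convert`: the two elaborations of the coin filter differ by a (subsingleton) instance
  have h1 : (univ.filter fun u : List.Vector Bool ℓ => hash (coinHash u.toList M k) x = 0).card *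
      Fintype.card (Hash M k) = (univ.filter fun h : Hash M k => hash h x = 0).card * 2 ^ ℓ := by
    convert card_filter_coinHash hℓ (fun h : Hash M k => hash h x = 0) using 4
  have h2 := card_filter_hash_eq (k := k) x 0
  have hpos : 0 < Fintype.card (Hash M k) := Fintype.card_pos
  apply Nat.eq_of_mul_eq_mul_right hpos
  calc (univ.filter fun u : List.Vector Bool ℓ => hash (coinHash u.toList M k) x = 0).card * 2 ^ k *
        Fintype.card (Hash M k)
      = (univ.filter fun u : List.Vector Bool ℓ => hash (coinHash u.toList M k) x = 0).card *
          Fintype.card (Hash M k) * 2 ^ k := by ring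
    _ = (univ.filter fun h : Hash M k => hash h x = 0).card * 2 ^ ℓ * 2 ^ k := by rw [h1]
    _ = (univ.filter fun h : Hash M k => hash h x = 0).card * 2 ^ k * 2 ^ ℓ := by ring
    _ = Fintype.card (Hash M k) * 2 ^ ℓ := by rw [h2]
    _ = 2 ^ ℓ * Fintype.card (Hash M k) := by ring

/-- The set-size lower bound through the coin layout: with `s = |S|`,
`2 s 2^k 2^ℓ ≤ 2 #{u | ∃ x ∈ S, h_k^u(x) = 0} 4^k + s (s - 1) 2^ℓ`.
[Arora–Barak 2009, Claim 8.16.1] [folklore] -/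
theorem card_coins_exists_hash_ge (hℓ : k * (M + 1) ≤ ℓ) (S : Finset (Fin M → ZMod 2)) :
    2 * S.card * 2 ^ k * 2 ^ ℓ ≤
      2 * (univ.filter fun u : List.Vector Bool ℓ => ∃ x ∈ S, hash (coinHash u.toList M k) x = 0).card *
          (2 ^ k * 2 ^ k) + S.card * (S.card - 1) * 2 ^ ℓ := by
  have h1 : (univ.filter fun u : List.Vector Bool ℓ => ∃ x ∈ S, hash (coinHash u.toList M k) x = 0).card *
      Fintype.card (Hash M k) = (univ.filter fun h : Hash M k => ∃ x ∈ S, hash h x = 0).card * 2 ^ ℓ := by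
    convert card_filter_coinHash hℓ (fun h : Hash M k => ∃ x ∈ S, hash h x = 0) using 4
  have h2 := card_exists_hash_ge (k := k) S 0
  have hpos : 0 < Fintype.card (Hash M k) := Fintype.card_pos
  apply Nat.le_of_mul_le_mul_right _ hpos
  have h3 := Nat.mul_le_mul_right (2 ^ ℓ) h2
  calc 2 * S.card * 2 ^ k * 2 ^ ℓ * Fintype.card (Hash M k)
      = 2 * S.card * 2 ^ k * Fintype.card (Hash M k) * 2 ^ ℓ := by ring
    _ ≤ (2 * (univ.filter fun h : Hash M k => ∃ x ∈ S, hash h x = 0).card * (2 ^ k * 2 ^ k) +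
          S.card * (S.card - 1) * Fintype.card (Hash M k)) * 2 ^ ℓ := h3
    _ = 2 * ((univ.filter fun h : Hash M k => ∃ x ∈ S, hash h x = 0).card * 2 ^ ℓ) * (2 ^ k * 2 ^ k) +
          S.card * (S.card - 1) * 2 ^ ℓ * Fintype.card (Hash M k) := by ring
    _ = 2 * ((univ.filter fun u : List.Vector Bool ℓ => ∃ x ∈ S, hash (coinHash u.toList M k) x = 0).card *
          Fintype.card (Hash M k)) * (2 ^ k * 2 ^ k) + S.card * (S.card - 1) * 2 ^ ℓ * Fintype.card (Hash M k) := by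
        rw [← h1]
    _ = _ := by ring

/-- **One round of the halving, at a good level.** `B` is the current bad set (embedded into the hash
domain by `e`), `beat` an oriented relation on it; from the coins `u` the round returns `found u`, which
is *some* element of `B` hashed to zero at level `k` whenever such an element exists, and the new bad
set `B' u ⊆ B` lies in the out-neighbourhood of the returned element. If `2^{k-2} ≤ |B| ≤ 2^{k-1}` then
`E_u |B' u| ≤ (29/32) |B|`. (The tree's replacement for the learning step of Köbler–Watanabe 1998,
Thm. 13; counting by Arora–Barak 2009, Thm. 8.15 and Claim 8.16.1.) [folklore] -/
theorem round_sum_le_level (hℓ : k * (M + 1) ≤ ℓ) (B : Finset α) (e : α → (Fin M → ZMod 2))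
    (he : Set.InjOn e ↑B) (beat : α → α → Prop) (hanti : ∀ a ∈ B, ∀ b ∈ B, beat a b → ¬ beat b a)
    (found : List.Vector Bool ℓ → Option α) (B' : List.Vector Bool ℓ → Finset α)
    (hsub : ∀ u, B' u ⊆ B)
    (hfound : ∀ u, (∃ a ∈ B, hash (coinHash u.toList M k) (e a) = 0) →
      ∃ a ∈ B, found u = some a ∧ hash (coinHash u.toList M k) (e a) = 0)
    (hbeat : ∀ u a, found u = some a → B' u ⊆ B.filter (beat a))
    (hlo : 2 ^ k ≤ 4 * B.card) (hhi : 2 * B.card ≤ 2 ^ k) :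
    32 * ∑ u : List.Vector Bool ℓ, ((B' u).card : ℝ) ≤ 29 * 2 ^ ℓ * B.card := by
  set zero : List.Vector Bool ℓ → α → Prop := fun u a => hash (coinHash u.toList M k) (e a) = 0 with hzero
  set od : α → ℕ := fun a => (B.filter (beat a)).card with hod
  -- pointwise bound on `|B' u|`
  have hpt : ∀ u, ((B' u).card : ℝ) ≤ (∑ a ∈ B, if zero u a then (od a : ℝ) else 0) +
      (if ∃ a ∈ B, zero u a then 0 else (B.card : ℝ)) := by
    intro u
    have hnn : 0 ≤ ∑ a ∈ B, (if zero u a then (od a : ℝ) else 0) :=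
      sum_nonneg fun _ _ => by split_ifs <;> positivity
    by_cases hE : ∃ a ∈ B, zero u a
    · obtain ⟨a, haB, hfa, hza⟩ := hfound u hE
      have h1 : ((B' u).card : ℝ) ≤ od a := by exact_mod_cast card_le_card (hbeat u a hfa)
      have h2 : (od a : ℝ) ≤ ∑ a' ∈ B, if zero u a' then (od a' : ℝ) else 0 := by
        rw [← sum_filter]
        exact single_le_sum (f := fun a' => (od a' : ℝ)) (fun _ _ => Nat.cast_nonneg _)
          (mem_filter.2 ⟨haB, hza⟩)
      rw [if_pos hE]
      linarith
    · rw [if_neg hE]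
      have : ((B' u).card : ℝ) ≤ B.card := by exact_mod_cast card_le_card (hsub u)
      linarith
  -- summing over the coins
  set cnt : α → ℕ := fun a => (univ.filter fun u : List.Vector Bool ℓ => zero u a).card with hcnt
  set NE : ℕ := (univ.filter fun u : List.Vector Bool ℓ => ∃ a ∈ B, zero u a).card with hNE
  have hsum : ∑ u, ((B' u).card : ℝ) ≤ (∑ a ∈ B, (od a : ℝ) * cnt a) + (B.card : ℝ) * (2 ^ ℓ - NE) := by
    calc ∑ u, ((B' u).card : ℝ)
        ≤ ∑ u, ((∑ a ∈ B, if zero u a then (od a : ℝ) else 0) +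
            (if ∃ a ∈ B, zero u a then 0 else (B.card : ℝ))) := sum_le_sum fun u _ => hpt u
      _ = (∑ a ∈ B, (od a : ℝ) * cnt a) + (B.card : ℝ) * (2 ^ ℓ - NE) := by
        rw [sum_add_distrib, sum_comm]
        congr 1
        · refine sum_congr rfl fun a _ => ?_
          rw [← sum_filter, sum_const, nsmul_eq_mul, mul_comm]
        · rw [sum_ite, sum_const_zero, zero_add, sum_const, nsmul_eq_mul, mul_comm]
          congr 1
          have hc := Finset.card_filter_add_card_filter_not
            (s := (univ : Finset (List.Vector Bool ℓ))) (fun u : List.Vector Bool ℓ => ∃ a ∈ B, zero u a)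
          rw [card_univ, card_coins] at hc
          have hc' : ((NE + (univ.filter fun u : List.Vector Bool ℓ => ¬ ∃ a ∈ B, zero u a).card : ℕ) : ℝ) =
              ((2 ^ ℓ : ℕ) : ℝ) := by rw [hNE]; exact_mod_cast hc
          push_cast at hc'
          linarith
  -- the two counting facts
  have hcnt : ∀ a, (cnt a : ℝ) * 2 ^ k = 2 ^ ℓ := fun a => by
    exact_mod_cast card_coins_hash_eq_zero hℓ (e a)
  have hspos : 1 ≤ B.card := by
    have : 1 ≤ 2 ^ k := Nat.one_le_two_pow
    omega
  have hNEge : 2 * (B.card : ℝ) * 2 ^ k * 2 ^ ℓ ≤ 2 * (NE : ℝ) * (2 ^ k * 2 ^ k) + B.card * (B.card - 1) * 2 ^ ℓ := by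
    have hS : (B.image e).card = B.card := card_image_of_injOn he
    have h := card_coins_exists_hash_ge hℓ (k := k) (B.image e)
    rw [hS] at h
    have hfilt : (univ.filter fun u : List.Vector Bool ℓ => ∃ x ∈ B.image e, hash (coinHash u.toList M k) x = 0) =
        univ.filter fun u : List.Vector Bool ℓ => ∃ a ∈ B, zero u a := by
      refine filter_congr fun u _ => ?_
      simp [hzero]
    rw [hfilt] at h
    have hcast : ((B.card * (B.card - 1) : ℕ) : ℝ) = B.card * (B.card - 1) := by
      rw [Nat.cast_mul, Nat.cast_sub hspos, Nat.cast_one]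
    have h' : ((2 * B.card * 2 ^ k * 2 ^ ℓ : ℕ) : ℝ) ≤ ((2 * NE * (2 ^ k * 2 ^ k) + B.card * (B.card - 1) * 2 ^ ℓ : ℕ) : ℝ) := by
      exact_mod_cast h
    push_cast [Nat.cast_sub hspos] at h'
    linarith
  -- out-degrees
  have hod_sum : ∑ a ∈ B, (od a : ℝ) ≤ B.card * (B.card - 1) / 2 := sum_outdeg_le B beat hanti
  -- algebra
  set s : ℝ := (B.card : ℝ) with hs
  set K : ℝ := 2 ^ k with hK
  set N : ℝ := 2 ^ ℓ with hN
  set x : ℝ := ∑ u, ((B' u).card : ℝ) with hx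
  have hKpos : 0 < K := by positivity
  have hNpos : 0 < N := by positivity
  have hs1 : 1 ≤ s := by rw [hs]; exact_mod_cast hspos
  have hKlo : K ≤ 4 * s := by rw [hK, hs]; exact_mod_cast hlo
  have hKhi : 2 * s ≤ K := by rw [hK, hs]; exact_mod_cast hhi
  have hsum' : K * x ≤ N * (∑ a ∈ B, (od a : ℝ)) + K * s * (N - NE) := by
    have h1 : K * ∑ a ∈ B, (od a : ℝ) * cnt a = N * ∑ a ∈ B, (od a : ℝ) := by
      rw [mul_sum, mul_sum]
      refine sum_congr rfl fun a _ => ?_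
      have := hcnt a
      calc K * ((od a : ℝ) * cnt a) = (od a : ℝ) * (cnt a * K) := by ring
        _ = N * od a := by rw [this]; ring
    have := mul_le_mul_of_nonneg_left hsum hKpos.le
    rw [mul_add, h1] at this
    linarith
  have hx2 : 2 * K ^ 2 * x ≤ N * (K * s * (s - 1) + 2 * K ^ 2 * s - 2 * s ^ 2 * K + s ^ 2 * (s - 1)) := by
    have h5 := mul_le_mul_of_nonneg_left hsum' (show (0 : ℝ) ≤ 2 * K by positivity)
    have h6 := mul_le_mul_of_nonneg_left hNEge (show (0 : ℝ) ≤ s by linarith)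
    have h7 := mul_le_mul_of_nonneg_left hod_sum (show (0 : ℝ) ≤ 2 * K * N by positivity)
    nlinarith [h5, h6, h7]
  have hprod : 0 ≤ N * s * ((3 * K - 4 * s) * (4 * s - K)) := by
    apply mul_nonneg (by positivity)
    apply mul_nonneg <;> linarith
  have hfin : 2 * K ^ 2 * (32 * x) ≤ 2 * K ^ 2 * (29 * N * s) := by
    nlinarith [hx2, hprod, mul_nonneg (mul_nonneg hNpos.le (by linarith : (0:ℝ) ≤ s)) hKpos.le,
      mul_nonneg (mul_nonneg hNpos.le (by linarith : (0:ℝ) ≤ s)) (by linarith : (0:ℝ) ≤ s)]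
  have := le_of_mul_le_mul_left hfin (by positivity)
  simpa [hx, hN, hs] using this

/-- `|B| ≤ 2^M` for a set embedded in `𝔽₂^M`. [folklore] -/
theorem card_le_two_pow_of_injOn (B : Finset α) (e : α → (Fin M → ZMod 2)) (he : Set.InjOn e ↑B) :
    B.card ≤ 2 ^ M := by
  rw [← card_image_of_injOn he, ← card_coinVec M]
  exact card_le_univ _

/-- **One round of the halving.** As `round_sum_le_level`, for a round returning some bad element
hashed to zero at level `k` whenever one exists, *for every* `k ≤ M + 2` (the machine runs one
search per level, `found k`, and appends everything it finds; the new bad set is in the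
out-neighbourhood of each appended element): `32 · Σ_u |B' u| ≤ 29 · 2^ℓ · |B|`, i.e.
`E_u |B' u| ≤ (29/32) |B|`, by choosing the good level of `|B|` (`AffineHash.exists_goodLevel`). [folklore] -/
theorem round_sum_le (hℓ : (M + 2) * (M + 1) ≤ ℓ) (B : Finset α) (e : α → (Fin M → ZMod 2))
    (he : Set.InjOn e ↑B) (beat : α → α → Prop) (hanti : ∀ a ∈ B, ∀ b ∈ B, beat a b → ¬ beat b a)
    (found : ℕ → List.Vector Bool ℓ → Option α) (B' : List.Vector Bool ℓ → Finset α)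
    (hsub : ∀ u, B' u ⊆ B)
    (hfound : ∀ k ≤ M + 2, ∀ u, (∃ a ∈ B, hash (coinHash u.toList M k) (e a) = 0) →
      ∃ a ∈ B, found k u = some a ∧ hash (coinHash u.toList M k) (e a) = 0)
    (hbeat : ∀ k u a, found k u = some a → B' u ⊆ B.filter (beat a)) :
    32 * ∑ u : List.Vector Bool ℓ, ((B' u).card : ℝ) ≤ 29 * 2 ^ ℓ * B.card := by
  rcases Nat.eq_zero_or_pos B.card with h0 | hpos
  · have hB0 : B = ∅ := card_eq_zero.1 h0
    have h' : ∀ u, B' u = ∅ := fun u => subset_empty.1 (hB0 ▸ hsub u)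
    simp [h', h0]
  · obtain ⟨k, hk, hlo, hhi⟩ := exists_goodLevel hpos (card_le_two_pow_of_injOn B e he)
    have hkℓ : k * (M + 1) ≤ ℓ := le_trans (Nat.mul_le_mul_right _ hk) hℓ
    exact round_sum_le_level hkℓ B e he beat hanti (found k) B' hsub (hfound k hk) (hbeat k) hlo hhi

end Round

/-! ### Iterating rounds with fresh coins -/

section Iterate

variable {σ X : Type*}

/-- The state after the rounds driven by the coin blocks `y 0, …, y (T-1)`. [folklore] -/
def runRounds (next : σ → X → σ) (s : σ) {T : ℕ} (y : Fin T → X) : σ :=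
  (List.ofFn y).foldl next s

/-- No rounds. [folklore] -/
@[simp] theorem runRounds_zero (next : σ → X → σ) (s : σ) (y : Fin 0 → X) : runRounds next s y = s := by
  simp [runRounds]

/-- Peeling the first round. [folklore] -/
theorem runRounds_cons (next : σ → X → σ) (s : σ) {T : ℕ} (x : X) (y : Fin T → X) :
    runRounds next s (Fin.cons x y : Fin (T + 1) → X) = runRounds next (next s x) y := by
  simp [runRounds, List.ofFn_succ]

/-- **Expected potential after `T` independent rounds.** If from every state one round multiplies the
summed potential by at most `c` (`Σ_x Φ (next s x) ≤ c Φ s`), then `T` rounds with independent coins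
multiply it by at most `c^T` (induction on `T`, conditioning on the first round). [Arora–Barak 2009,
§A.2 (linearity of expectation, iterated)] [folklore] -/
theorem iterate_sum_le [Fintype X] (next : σ → X → σ) (Φ : σ → ℝ) {c : ℝ} (hc : 0 ≤ c)
    (h : ∀ s, ∑ x, Φ (next s x) ≤ c * Φ s) :
    ∀ (T : ℕ) (s : σ), ∑ y : Fin T → X, Φ (runRounds next s y) ≤ c ^ T * Φ s
  | 0, s => by simp
  | T + 1, s => by
    have hsplit : ∑ y : Fin (T + 1) → X, Φ (runRounds next s y) =
        ∑ p : X × (Fin T → X), Φ (runRounds next (next s p.1) p.2) := by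
      refine (Fintype.sum_equiv (Fin.consEquiv fun _ : Fin (T + 1) => X) _ _ fun p => ?_).symm
      change Φ (runRounds next (next s p.1) p.2) = Φ (runRounds next s (Fin.cons p.1 p.2))
      rw [runRounds_cons]
    rw [hsplit, Fintype.sum_prod_type]
    calc ∑ x, ∑ y : Fin T → X, Φ (runRounds next (next s x) y)
        ≤ ∑ x, c ^ T * Φ (next s x) := sum_le_sum fun x _ => iterate_sum_le next Φ hc h T (next s x)
      _ = c ^ T * ∑ x, Φ (next s x) := by rw [mul_sum]
      _ ≤ c ^ T * (c * Φ s) := mul_le_mul_of_nonneg_left (h s) (pow_nonneg hc T)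
      _ = c ^ (T + 1) * Φ s := by ring

end Iterate

/-! ### The failure probability of the whole construction -/

section Failure

variable {α σ : Type*} {ℓ M T : ℕ}

/-- `(29/32)^8 ≤ 1/2`. [folklore] -/
theorem ratio_pow_eight_le : ((29 : ℝ) / 32) ^ 8 ≤ 1 / 2 := by norm_num

/-- **The advice construction fails with probability at most `1/2`.** For a process on states `σ`
driven by coin blocks of length `ℓ`, whose bad sets `Bd` shrink in expectation by `29/32` per round
from every state (`round_sum_le`), started with `|Bd s₀| ≤ 2^M` and run for `T ≥ 8(M+1)` rounds:
at most half of the coin sequences end with a nonempty bad set (Markov on `E|Bd_T| ≤ (29/32)^T 2^M`).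
[folklore] -/
theorem two_mul_card_nonempty_le (next : σ → List.Vector Bool ℓ → σ) (Bd : σ → Finset α)
    (hround : ∀ s, 32 * ∑ u : List.Vector Bool ℓ, ((Bd (next s u)).card : ℝ) ≤ 29 * 2 ^ ℓ * (Bd s).card)
    (s₀ : σ) (h₀ : (Bd s₀).card ≤ 2 ^ M) (hT : 8 * (M + 1) ≤ T) :
    2 * ((univ.filter fun y : Fin T → List.Vector Bool ℓ => (Bd (runRounds next s₀ y)).Nonempty).card : ℝ) ≤
      (2 ^ ℓ) ^ T := by
  set c : ℝ := 29 / 32 * 2 ^ ℓ with hc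
  have hc0 : 0 ≤ c := by positivity
  have hstep : ∀ s, ∑ u : List.Vector Bool ℓ, ((Bd (next s u)).card : ℝ) ≤ c * (Bd s).card := by
    intro s; have := hround s; rw [hc]; linarith
  have hiter := iterate_sum_le next (fun s => ((Bd s).card : ℝ)) hc0 hstep T s₀
  -- Markov: the number of nonempty outcomes is at most the summed cardinality
  have hmarkov : ((univ.filter fun y : Fin T → List.Vector Bool ℓ => (Bd (runRounds next s₀ y)).Nonempty).card : ℝ) ≤
      ∑ y : Fin T → List.Vector Bool ℓ, ((Bd (runRounds next s₀ y)).card : ℝ) := by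
    rw [card_eq_sum_ones, Nat.cast_sum, ← sum_filter_add_sum_filter_not univ
      (fun y : Fin T → List.Vector Bool ℓ => (Bd (runRounds next s₀ y)).Nonempty)]
    have h1 : ∑ y ∈ univ.filter (fun y : Fin T → List.Vector Bool ℓ => (Bd (runRounds next s₀ y)).Nonempty),
        ((1 : ℕ) : ℝ) ≤ ∑ y ∈ univ.filter (fun y : Fin T → List.Vector Bool ℓ => (Bd (runRounds next s₀ y)).Nonempty),
        ((Bd (runRounds next s₀ y)).card : ℝ) := by
      refine sum_le_sum fun y hy => ?_
      rw [mem_filter] at hy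
      exact_mod_cast hy.2.card_pos
    have h2 : 0 ≤ ∑ y ∈ univ.filter (fun y : Fin T → List.Vector Bool ℓ => ¬ (Bd (runRounds next s₀ y)).Nonempty),
        ((Bd (runRounds next s₀ y)).card : ℝ) := sum_nonneg fun _ _ => Nat.cast_nonneg _
    linarith
  -- `(29/32)^T 2^M ≤ 1/2`
  have hpow : 2 * ((29 : ℝ) / 32) ^ T * 2 ^ M ≤ 1 := by
    have h1 : ((29 : ℝ) / 32) ^ T ≤ ((29 : ℝ) / 32) ^ (8 * (M + 1)) :=
      pow_le_pow_of_le_one (by norm_num) (by norm_num) hT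
    have h2 : ((29 : ℝ) / 32) ^ (8 * (M + 1)) ≤ (1 / 2) ^ (M + 1) := by
      rw [pow_mul]
      exact pow_le_pow_left₀ (by positivity) ratio_pow_eight_le (M + 1)
    have h3 : (2 : ℝ) * (1 / 2) ^ (M + 1) * 2 ^ M = 1 := by
      rw [pow_succ, one_div, inv_pow]
      field_simp
    have h4 : (0 : ℝ) ≤ 2 ^ M := by positivity
    nlinarith [h1, h2, h3, h4, pow_nonneg (show (0:ℝ) ≤ 29 / 32 by norm_num) T]
  have hcT : c ^ T = ((29 : ℝ) / 32) ^ T * (2 ^ ℓ) ^ T := by rw [hc, mul_pow]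
  have h₀' : ((Bd s₀).card : ℝ) ≤ 2 ^ M := by exact_mod_cast h₀
  have hposℓ : (0 : ℝ) ≤ (2 ^ ℓ) ^ T := by positivity
  calc 2 * ((univ.filter fun y : Fin T → List.Vector Bool ℓ => (Bd (runRounds next s₀ y)).Nonempty).card : ℝ)
      ≤ 2 * (c ^ T * (Bd s₀).card) := by linarith
    _ ≤ 2 * (((29 : ℝ) / 32) ^ T * (2 ^ ℓ) ^ T * 2 ^ M) := by
        rw [hcT]
        refine mul_le_mul_of_nonneg_left (mul_le_mul_of_nonneg_left h₀' (by positivity)) (by norm_num)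
    _ = (2 * ((29 : ℝ) / 32) ^ T * 2 ^ M) * (2 ^ ℓ) ^ T := by ring
    _ ≤ 1 * (2 ^ ℓ) ^ T := mul_le_mul_of_nonneg_right hpow hposℓ
    _ = (2 ^ ℓ) ^ T := one_mul _

/-! ### The same read off one long coin string, block by block -/

/-- The `T` blocks of length `ℓ` of a coin string (coins beyond `T ℓ` are ignored). [folklore] -/
def blocks (T ℓ : ℕ) (r : List Bool) : List (List Bool) :=
  (List.range T).map fun j => (r.drop (j * ℓ)).take ℓ

/-- The blocks only depend on the first `T ℓ` coins. [folklore] -/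
theorem blocks_take (T ℓ : ℕ) (r : List Bool) : blocks T ℓ (r.take (T * ℓ)) = blocks T ℓ r := by
  unfold blocks
  refine List.map_congr_left fun j hj => ?_
  rw [List.mem_range] at hj
  rw [List.drop_take, List.take_take]
  have : (j + 1) * ℓ ≤ T * ℓ := Nat.mul_le_mul_right ℓ hj
  rw [Nat.succ_mul] at this
  rw [min_eq_left (by omega)]

/-- The blocks of a string of length exactly `T ℓ` are its chunks. [folklore] -/
theorem blocks_eq_ofFn_chunkVec {T ℓ : ℕ} (v : List.Vector Bool (T * ℓ)) :
    blocks T ℓ v.toList = List.ofFn fun j => (chunkVec v j).toList :=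
  map_range_chunk_eq_ofFn v

/-- Events that agree on the strings of length `m` have the same `uniformProb m` (a copy of the
five-line lemma of `CountingHierarchyPPoly.lean`, to keep this file's imports light). [folklore] -/
private theorem uniformProb_congr_of_length {m : ℕ} {E E' : Set (List Bool)}
    (h : ∀ y : List Bool, y.length = m → (y ∈ E ↔ y ∈ E')) : uniformProb m E = uniformProb m E' := by
  unfold uniformProb
  rw [filter_congr fun (v : List.Vector Bool m) _ => h v.toList v.toList_length]

/-- **An event of the first `a` coins** has the same probability over `a + d` coins. [Arora–Barak 2009, §A.2] [folklore] -/
theorem uniformProb_take_eq (a d : ℕ) (P : List Bool → Prop) :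
    uniformProb (a + d) {r | P (r.take a)} = uniformProb a {r | P r} := by
  rw [uniformProb_eq_card_fun, uniformProb_eq_card_fun, pow_add]
  have key : ∀ {A B : ℕ}, A = B * 2 ^ d → (A : ℝ) / (2 ^ a * 2 ^ d) = B / 2 ^ a := by
    intro A B h
    rw [h]
    push_cast
    have h2 : (2 : ℝ) ^ d ≠ 0 := by positivity
    field_simp
  apply key
  rw [← card_fun_fin_bool d, ← card_univ, ← card_product]
  set e : (Fin a → Bool) × (Fin d → Bool) ≃ (Fin (a + d) → Bool) := Fin.appendEquiv a d with he
  symm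
  refine card_equiv e fun p => ?_
  obtain ⟨g, h⟩ := p
  have hsplit : List.ofFn (e (g, h)) = List.ofFn g ++ List.ofFn h := by
    simp [he, Fin.appendEquiv, List.ofFn_fin_append]
  have hg : (List.ofFn g).length = a := List.length_ofFn
  simp only [mem_product, mem_filter, mem_univ, true_and, and_true, Set.mem_setOf_eq, hsplit]
  rw [List.take_left' hg]

/-- **The advice construction fails with probability at most `1/2`, over a coin string.** The
process reads its `T` rounds of coins as the consecutive blocks of length `ℓ` of one uniform string of
any length `m ≥ T ℓ`. [folklore] -/
theorem uniformProb_nonempty_le_half (next : σ → List Bool → σ) (Bd : σ → Finset α)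
    (hround : ∀ s, 32 * ∑ u : List.Vector Bool ℓ, ((Bd (next s u.toList)).card : ℝ) ≤ 29 * 2 ^ ℓ * (Bd s).card)
    (s₀ : σ) (h₀ : (Bd s₀).card ≤ 2 ^ M) (hT : 8 * (M + 1) ≤ T) {m : ℕ} (hm : T * ℓ ≤ m) :
    uniformProb m {r | (Bd ((blocks T ℓ r).foldl next s₀)).Nonempty} ≤ 1 / 2 := by
  obtain ⟨d, rfl⟩ := Nat.exists_eq_add_of_le hm
  have hev : {r : List Bool | (Bd ((blocks T ℓ r).foldl next s₀)).Nonempty} =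
      {r | (fun r' => (Bd ((blocks T ℓ r').foldl next s₀)).Nonempty) (r.take (T * ℓ))} := by
    ext r
    simp only [Set.mem_setOf_eq, blocks_take]
  rw [hev, uniformProb_take_eq (T * ℓ) d (fun r' => (Bd ((blocks T ℓ r').foldl next s₀)).Nonempty)]
  -- over strings of the exact length `T ℓ`: chunks
  set next' : σ → List.Vector Bool ℓ → σ := fun s u => next s u.toList with hnext'
  have hrun : ∀ v : List.Vector Bool (T * ℓ),
      (blocks T ℓ v.toList).foldl next s₀ = runRounds next' s₀ (chunkVec v) := by
    intro v
    rw [blocks_eq_ofFn_chunkVec, runRounds,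
      show (List.ofFn fun j => (chunkVec v j).toList) = (List.ofFn (chunkVec v)).map List.Vector.toList from
        List.map_ofFn.symm, List.foldl_map]
  have hcongr : uniformProb (T * ℓ) {r | (Bd ((blocks T ℓ r).foldl next s₀)).Nonempty} =
      uniformProb (T * ℓ) {w | ∃ h : w.length = T * ℓ,
        (fun f : Fin T → List.Vector Bool ℓ => (Bd (runRounds next' s₀ f)).Nonempty)
          (chunkVec (⟨w, h⟩ : List.Vector Bool (T * ℓ)))} := by
    refine uniformProb_congr_of_length fun r hr => ?_
    simp only [Set.mem_setOf_eq]
    have hv := hrun (⟨r, hr⟩ : List.Vector Bool (T * ℓ))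
    change List.foldl next s₀ (blocks T ℓ r) = _ at hv
    rw [hv]
    exact ⟨fun h => ⟨hr, h⟩, fun ⟨_, h⟩ => h⟩
  rw [hcongr, uniformProb_eq_card_of_bijective chunkVec (chunkVec_bijective T ℓ)
    (fun f : Fin T → List.Vector Bool ℓ => (Bd (runRounds next' s₀ f)).Nonempty)]
  have hcardS : (Fintype.card (Fin T → List.Vector Bool ℓ) : ℝ) = (2 ^ ℓ) ^ T := by
    rw [Fintype.card_fun, Fintype.card_fin, card_vector, Fintype.card_bool]; push_cast; ring
  have h := two_mul_card_nonempty_le next' Bd hround s₀ h₀ hT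
  rw [hcardS, div_le_iff₀ (by positivity)]
  linarith

end Failure

/-! ### Strings of bounded length inside the hash domain `𝔽₂^{m+1}` -/

section Embed

open Stockmeyer AffineHash

/-- The end marker: `mark u = u·1`. Strings of length `≤ m` followed by the marker (and, implicitly,
zeros) are distinct points of `{0,1}^{m+1}`. [folklore] -/
def mark (u : List Bool) : List Bool := u ++ [true]

/-- `|mark u| = |u| + 1`. [folklore] -/
@[simp] theorem length_mark (u : List Bool) : (mark u).length = u.length + 1 := by
  simp [mark]

/-- Reading `mark u`: the bits of `u`, then the marker, then nothing. [folklore] -/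
theorem getD_mark (u : List Bool) (i : ℕ) :
    (mark u).getD i false = if h : i < u.length then u[i] else decide (i = u.length) := by
  unfold mark
  split_ifs with h
  · rw [List.getD_eq_getElem _ _ (by simp; omega), List.getElem_append_left h]
  · rcases Nat.eq_or_lt_of_le (Nat.not_lt.1 h) with h1 | h1
    · subst h1
      rw [List.getD_eq_getElem _ _ (by simp), List.getElem_append_right (le_refl _)]
      simp
    · rw [List.getD_eq_default _ _ (by simp; omega)]
      simp
      omega

/-- **The embedding** of strings of length `≤ m` into the hash domain `𝔽₂^{m+1}`:
`u ↦ (u·1·0^{m-|u|})` read through `Bool ↪ 𝔽₂`. [folklore] -/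
def embed (m : ℕ) (u : List Bool) : Fin (m + 1) → ZMod 2 := fun i => bz ((mark u).getD i false)

/-- The embedding is injective on strings of length `≤ m`. [folklore] -/
theorem embed_injOn (m : ℕ) : Set.InjOn (embed m) {u : List Bool | u.length ≤ m} := by
  intro u hu v hv h
  simp only [Set.mem_setOf_eq] at hu hv
  have hbit : ∀ i ≤ m, (mark u).getD i false = (mark v).getD i false := fun i hi =>
    bz_injective (congrFun h ⟨i, Nat.lt_succ_of_le hi⟩)
  have hlen : u.length = v.length := by
    by_contra hne
    rcases Nat.lt_or_gt_of_ne hne with hlt | hlt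
    · have h1 := hbit v.length hv
      rw [getD_mark, getD_mark, dif_neg (by omega), dif_neg (lt_irrefl _)] at h1
      simp at h1; omega
    · have h1 := hbit u.length hu
      rw [getD_mark, getD_mark, dif_neg (lt_irrefl _), dif_neg (by omega)] at h1
      simp at h1; omega
  refine List.ext_getElem hlen fun i h1 h2 => ?_
  have hi := hbit i (by omega)
  rw [getD_mark, getD_mark, dif_pos h1, dif_pos h2] at hi
  exact hi

/-- Trailing zeros do not change an `𝔽₂` inner product. [folklore] -/
theorem count_zipWith_and_append_replicate_false (a y : List Bool) (r : ℕ) :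
    ((a.zipWith (· && ·) (y ++ List.replicate r false)).count true) = ((a.zipWith (· && ·) y).count true) := by
  induction y generalizing a with
  | nil =>
    rw [List.nil_append, List.zipWith_nil_right, List.count_nil]
    induction r generalizing a with
    | zero => simp
    | succ r ih =>
      cases a with
      | nil => simp
      | cons x a => rw [List.replicate_succ, List.zipWith_cons_cons, List.count_cons, ih]; simp
  | cons b y ih =>
    cases a with
    | nil => simp
    | cons x a => rw [List.cons_append, List.zipWith_cons_cons, List.zipWith_cons_cons, List.count_cons,
        List.count_cons, ih]

/-- Trailing zeros do not change the row parities. [folklore] -/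
theorem rowParity_append_replicate_false (c : List Bool) (M : ℕ) (y : List Bool) (r j : ℕ) :
    rowParity c M (y ++ List.replicate r false) j = rowParity c M y j := by
  unfold rowParity
  rw [count_zipWith_and_append_replicate_false]

/-- Trailing zeros do not change hashing to zero. [folklore] -/
theorem hashesToZero_append_replicate_false (c : List Bool) (M k : ℕ) (y : List Bool) (r : ℕ) :
    HashesToZero c M k (y ++ List.replicate r false) ↔ HashesToZero c M k y := by
  unfold HashesToZero
  simp only [rowParity_append_replicate_false]

/-- The padded marker string as a vector of length `m + 1`. [folklore] -/
def padVec (m : ℕ) (u : List Bool) (hu : u.length ≤ m) : List.Vector Bool (m + 1) :=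
  ⟨mark u ++ List.replicate (m - u.length) false, by simp; omega⟩

/-- The embedding is the padded vector read in `𝔽₂`. [folklore] -/
theorem embed_eq_toZ {m : ℕ} {u : List Bool} (hu : u.length ≤ m) : embed m u = toZ (padVec m u hu) := by
  funext i
  change bz ((mark u).getD i false) = bz ((padVec m u hu).get i)
  rw [get_eq_getD]
  change bz ((mark u).getD i false) = bz ((mark u ++ List.replicate (m - u.length) false).getD i false)
  congr 1
  rw [List.getD_eq_getElem?_getD, List.getD_eq_getElem?_getD]
  by_cases hi : (i : ℕ) < (mark u).length
  · rw [List.getElem?_append_left hi]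
  · rw [List.getElem?_append_right (Nat.not_lt.1 hi), List.getElem?_eq_none (Nat.not_lt.1 hi)]
    simp

/-- **Hashing an embedded string to zero is the bit-level test on the marked string** (what the
verifier computes, `Stockmeyer.rowParity`). [folklore] -/
theorem hash_embed_eq_zero_iff (c : List Bool) {m k : ℕ} {u : List Bool} (hu : u.length ≤ m) :
    hash (coinHash c (m + 1) k) (embed m u) = 0 ↔ HashesToZero c (m + 1) k (mark u) := by
  rw [embed_eq_toZ hu, hash_coinHash_eq_zero_iff]
  exact hashesToZero_append_replicate_false c (m + 1) k (mark u) (m - u.length)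

/-- Deeper levels hash to zero less often: zero at level `k'` implies zero at every level `k ≤ k'`.
[folklore] -/
theorem hashesToZero_mono {c : List Bool} {M k k' : ℕ} {y : List Bool} (hk : k ≤ k')
    (h : HashesToZero c M k' y) : HashesToZero c M k y :=
  fun j hj => h j (lt_of_lt_of_le hj hk)

end Embed

end CFKer

end Literature.Computability.Complexity
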